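import Summits.CriticalPhenomena.SAWScalingLimit.Theorems.BoundaryTP2.Negative.TP2CertGraph
import Summits.CriticalPhenomena.SAWScalingLimit.Theorems.BoundaryTP2.Negative.TP2CertFull
import Summits.CriticalPhenomena.SAWScalingLimit.Theorems.SAWTotalPositivityBoundaryHarnackRealisation
import HarnessLib

/-!
# Crux `BoundaryTP2` (stmt-CriticalPhenomena-7115): the full typed instance at graph level (arbitrary site lists)

Certified-compute seat (refuter `ccert`), part 5: the graph-level analogue of `TP2CertFull` for `ℤ²[VS]`
(any `G` with `G.Adj x y ↔ (zdGraph 2).Adj x y ∧ x ∈ VS ∧ y ∈ VS`, `VS` duplicate-free).  `fullCheckAtV VS K F ctab i₁`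
runs over the ordered quadruples of listed sites with first index `i₁` minimal and, for each, passes the exact
subdivision certificate of part 1 or FINDS a disjoint realisation of the crossing pairing (a path `p₁ → p₃`
avoiding `p₂, p₄` and a path `p₂ → p₄` avoiding it) refuting interlacing; the Klein relabellings reduce every
quadruple to a canonical one.  `graphTP2_of_fullCheckV`: TP₂ for EVERY interlaced, disjointly realisable
quadruple of `G` at every `x ∈ [10/27, 5/13]`.  §4–§6 (formerly a separate `TP2CertRealise`): for a duplicate-free, lattice-connected `VS` inside a box `[lo, hi]`, the
realisation `ΩV lo hi VS = realise lo hi {v | v ∈ VS}` (`…BoundaryHarnackRealisation`) is a bounded simply connected domain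
with `Ω_1 = ℤ²[VS]` (`adj_ΩV_iff`; lattice-connectedness by the kernel: `connCheck`), so the certificates become statements
about the crux's own `SAW.weight (ΩV lo hi VS) 1 · · univ` at `x_c`: `tp2_weight_ΩV_of_certAll`,
`boundaryTP2_ΩV_of_fullCheckV` (the crux AS TYPED on `Ω = ΩV lo hi VS`, `δ = 1`).  Everything proved. [folklore]
-/

namespace Summit.CriticalPhenomena.SAWScalingLimit.Theorems.BoundaryTP2.Negative.Cert

open Literature.Probability.LatticeModels Literature.Probability.RandomPlanarGeometry
open Summit.CriticalPhenomena.SAWScalingLimit.Theorems.EdgeOfPositivity.Negative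
open Summit.CriticalPhenomena.SAWScalingLimit.Theorems.BoundaryTP2
open scoped ENNReal

/-! ## §1 Searching disjoint realisations of the crossing pairing in `ℤ²[VS]` -/

section GraphFull

variable (VS : List (Site 2))

/-- Neighbour lists of `ℤ²[VS]` avoiding a list of forbidden sites. [folklore] -/
def nbrAvoidV (bad : List (Site 2)) (v : Site 2) : List (Site 2) :=
  (nbrV VS v).filter fun w => w ∉ bad

variable {VS} {G : SimpleGraph (Site 2)}

/-- **Soundness of the avoiding enumerator**: every listed sequence is the support of a self-avoiding walk of
the box from `u`, all of whose other vertices avoid `bad`. [folklore] -/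
theorem exists_walk_of_mem_allPaths_nbrAvoidV
    (hG : ∀ x y, G.Adj x y ↔ (zdGraph 2).Adj x y ∧ x ∈ VS ∧ y ∈ VS) {bad : List (Site 2)} {u v : Site 2}
    {L : List (Site 2)} (hu : u ∈ VS) (hL : L ∈ allPaths (nbrAvoidV VS bad) v (VS.length - 1) u []) :
    ∃ p : G.Walk u v, p.IsPath ∧ p.support = L ∧ ∀ w ∈ L, w = u ∨ w ∉ bad := by
  obtain ⟨rest, rfl, hf, hnd, -, hlast⟩ := allPaths_sound (nbrAvoidV VS bad) v _ u [] L hL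
  have hadj : ∀ x y : Site 2, x ∈ {w | w ∈ VS} → y ∈ nbrAvoidV VS bad x → G.Adj x y := fun x y hx hy =>
    (hG x y).2 ⟨(mem_nbrV_iff.1 (List.mem_filter.1 hy).1).2, hx, (mem_nbrV_iff.1 (List.mem_filter.1 hy).1).1⟩
  have hS : ∀ x y : Site 2, x ∈ {w | w ∈ VS} → y ∈ nbrAvoidV VS bad x → y ∈ {w | w ∈ VS} :=
    fun x y _ hy => (mem_nbrV_iff.1 (List.mem_filter.1 hy).1).1
  subst hlast
  refine ⟨walkOf (nbrAvoidV VS bad) {w | w ∈ VS} hadj hS u rest hu hf, ?_, support_walkOf _ _ _ _ _ _ _ _, ?_⟩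
  · exact SimpleGraph.Walk.IsPath.mk' (by rw [support_walkOf]; exact hnd)
  · intro w hw
    rcases List.mem_cons.1 hw with rfl | hw
    · exact Or.inl rfl
    · obtain ⟨c, hc⟩ := Follows.forall_mem hf w hw
      have := (List.mem_filter.1 hc).2
      simp only [decide_eq_true_eq] at this
      exact Or.inr this

/-- **Witness search**: a SAW `P : p₁ → p₃` avoiding `p₂, p₄` such that some SAW `p₂ → p₄` avoids `P`
(the crossing pairing is disjointly realisable; kernel-lazy). [folklore] -/
def disjointWitnessV (VS : List (Site 2)) (p₁ p₂ p₃ p₄ : Site 2) : Bool :=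
  ((allPaths (nbrAvoidV VS [p₂, p₄]) p₃ (VS.length - 1) p₁ []).find? fun P =>
      !(allPaths (nbrAvoidV VS P) p₄ (VS.length - 1) p₂ []).isEmpty).isSome

/-- **A found witness refutes interlacing.** [folklore] -/
theorem not_interlaced_of_disjointWitnessV
    (hG : ∀ x y, G.Adj x y ↔ (zdGraph 2).Adj x y ∧ x ∈ VS ∧ y ∈ VS) {p₁ p₂ p₃ p₄ : Site 2}
    (h : disjointWitnessV VS p₁ p₂ p₃ p₄ = true) (h₁ : p₁ ∈ VS) (h₂ : p₂ ∈ VS)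
    (h12 : p₁ ≠ p₂) : ¬ Interlaced G p₁ p₂ p₃ p₄ := by
  intro hI
  rw [disjointWitnessV, Option.isSome_iff_exists] at h
  obtain ⟨P, hP⟩ := h
  have hPmem := List.mem_of_find?_eq_some hP
  have hPQ := List.find?_some hP
  obtain ⟨Q, hQ⟩ : ∃ Q, Q ∈ allPaths (nbrAvoidV VS P) p₄ (VS.length - 1) p₂ [] := by
    cases hl : allPaths (nbrAvoidV VS P) p₄ (VS.length - 1) p₂ [] with
    | nil => rw [hl] at hPQ; simp at hPQ
    | cons Q l => exact ⟨Q, List.mem_cons_self⟩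
  obtain ⟨p, hp, hpsupp, hpav⟩ := exists_walk_of_mem_allPaths_nbrAvoidV hG h₁ hPmem
  obtain ⟨q, hq, hqsupp, hqav⟩ := exists_walk_of_mem_allPaths_nbrAvoidV hG h₂ hQ
  obtain ⟨v, hvp, hvq⟩ := hI ⟨p, hp⟩ ⟨q, hq⟩
  have hvP : v ∈ P := by rw [← hpsupp]; exact hvp
  have hvQ : v ∈ Q := by rw [← hqsupp]; exact hvq
  rcases hqav v hvQ with rfl | hv
  · -- `v = p₂` lies on `P`, but `P` avoids `p₂` (and `p₁ ≠ p₂`)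
    rcases hpav _ hvP with h | h
    · exact h12 h.symm
    · exact h (by simp)
  · exact hv hvP

/-! ## §2 The full checker -/

/-- One ordered quadruple of site indices: certificate, else witness (`cfs`, `violatedLo` from part 3's
box version are re-declared here with a `V`). [folklore] -/
def cfsV (ctab : List (List (List ℕ))) (i j : ℕ) : List ℕ := if i < j then cf ctab i j else cf ctab j i

/-- Cheap pre-test: the inequality is already violated at `x = 10/27`. [folklore] -/
def violatedLoV (K : ℕ) (A B C D : List ℕ) : Bool :=
  Nat.blt (hornerH K A 130 351 * hornerH K B 130 351) (hornerH K C 130 351 * hornerH K D 130 351)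

/-- One ordered quadruple of listed-site indices: certificate, else witness. [folklore] -/
def quadFullV (VS : List (Site 2)) (K F : ℕ) (ctab : List (List (List ℕ))) (i₁ i₂ i₃ i₄ : ℕ) : Bool :=
  (!violatedLoV K (cfsV ctab i₁ i₂) (cfsV ctab i₃ i₄) (cfsV ctab i₁ i₃) (cfsV ctab i₂ i₄) &&
      certRec K (cfsV ctab i₁ i₂) (cfsV ctab i₃ i₄) (cfsV ctab i₁ i₃) (cfsV ctab i₂ i₄) F 0 0) ||
    disjointWitnessV VS (VS.getD i₁ 0) (VS.getD i₂ 0) (VS.getD i₃ 0) (VS.getD i₄ 0)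

/-- **The full checker at first index `i₁`**: table lengths, and every ordered quadruple of pairwise distinct
indices with `i₁` minimal. [folklore] -/
def fullCheckAtV (VS : List (Site 2)) (K F : ℕ) (ctab : List (List (List ℕ))) (i₁ : ℕ) : Bool :=
  lenOK K ctab &&
    (List.range VS.length).all fun i₂ => (List.range VS.length).all fun i₃ =>
      (List.range VS.length).all fun i₄ =>
        !(decide (i₁ < i₂) && decide (i₁ < i₃) && decide (i₁ < i₄) && !(i₂ == i₃) && !(i₂ == i₄) && !(i₃ == i₄)) ||
          quadFullV VS K F ctab i₁ i₂ i₃ i₄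

/-! ## §3 Soundness -/

variable {K F : ℕ} {ctab : List (List (List ℕ))}

/-- The symmetrised lookup is the path kernel, for distinct in-range indices. [folklore] -/
theorem pathKernel_eq_cfsV (hG : ∀ x y, G.Adj x y ↔ (zdGraph 2).Adj x y ∧ x ∈ VS ∧ y ∈ VS) (hVS : VS.Nodup)
    (hct : (rowsOf VS).map (List.map fun p : Site 2 × Site 2 => pathCountV VS p.1 p.2) = ctab)
    {i j : ℕ} (hij : i ≠ j) (hi : i < VS.length) (hj : j < VS.length) {x : ℝ} (hx : 0 ≤ x) :
    pathKernel G x (VS.getD i 0) (VS.getD j 0) = ENNReal.ofReal (evPoly (cfsV ctab i j) x) := by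
  have hmem : ∀ n, n < VS.length → VS.getD n 0 ∈ VS := fun n hn => by
    rw [List.getD_eq_getElem _ _ hn]; exact List.getElem_mem hn
  unfold cfsV
  split_ifs with hlt
  · rw [pathKernel_eq_evPolyV hG hVS (hmem i hi) hx, cf_eq_apply hct hlt hj]
  · have hji : j < i := lt_of_le_of_ne (not_lt.1 hlt) (Ne.symm hij)
    rw [pathKernel_comm, pathKernel_eq_evPolyV hG hVS (hmem j hj) hx, cf_eq_apply hct hji hi]

/-- **Soundness in canonical position** (`i₁` minimal). [folklore] -/
theorem tp2_canonical_of_fullCheckAtV (hG : ∀ x y, G.Adj x y ↔ (zdGraph 2).Adj x y ∧ x ∈ VS ∧ y ∈ VS)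
    (hVS : VS.Nodup) (hct : (rowsOf VS).map (List.map fun p : Site 2 × Site 2 => pathCountV VS p.1 p.2) = ctab)
    {i₁ : ℕ} (h : fullCheckAtV VS K F ctab i₁ = true) {i₂ i₃ i₄ : ℕ} (h12 : i₁ < i₂) (h13 : i₁ < i₃)
    (h14 : i₁ < i₄) (h23 : i₂ ≠ i₃) (h24 : i₂ ≠ i₄) (h34 : i₃ ≠ i₄) (hi₂ : i₂ < VS.length)
    (hi₃ : i₃ < VS.length) (hi₄ : i₄ < VS.length) {x : ℝ} (hlo : 10 / 27 ≤ x) (hhi : x ≤ 5 / 13)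
    (hI : Interlaced G (VS.getD i₁ 0) (VS.getD i₂ 0) (VS.getD i₃ 0) (VS.getD i₄ 0)) :
    pathKernel G x (VS.getD i₁ 0) (VS.getD i₃ 0) * pathKernel G x (VS.getD i₂ 0) (VS.getD i₄ 0) ≤
      pathKernel G x (VS.getD i₁ 0) (VS.getD i₂ 0) * pathKernel G x (VS.getD i₃ 0) (VS.getD i₄ 0) := by
  have hi₁ : i₁ < VS.length := h12.trans hi₂
  have hx : 0 ≤ x := le_trans (by norm_num) hlo
  simp only [fullCheckAtV, Bool.and_eq_true, List.all_eq_true, List.mem_range] at h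
  obtain ⟨hlen, hall⟩ := h
  have hq := hall i₂ hi₂ i₃ hi₃ i₄ hi₄
  have hguard : (decide (i₁ < i₂) && decide (i₁ < i₃) && decide (i₁ < i₄) && !(i₂ == i₃) && !(i₂ == i₄) &&
      !(i₃ == i₄)) = true := by simp [h12, h13, h14, h23, h24, h34]
  rw [hguard] at hq
  simp only [Bool.not_true, Bool.false_or, quadFullV, Bool.or_eq_true, Bool.and_eq_true] at hq
  rcases hq with ⟨-, hcert⟩ | hwit
  · have hL := fun i j => show (cfsV ctab i j).length ≤ K + 1 by
      unfold cfsV; split_ifs <;> exact length_cf_le hlen _ _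
    have h1 : tR 0 0 ≤ x := by rw [tR_zero_zero]; exact hlo
    have h2 : x ≤ tR 0 (0 + 1) := by rw [zero_add, tR_zero_one]; exact hhi
    have key := certRec_sound (hL i₁ i₂) (hL i₃ i₄) (hL i₁ i₃) (hL i₂ i₄) F 0 0 hcert h1 h2
    rw [pathKernel_eq_cfsV hG hVS hct (ne_of_lt h13) hi₁ hi₃ hx, pathKernel_eq_cfsV hG hVS hct h24 hi₂ hi₄ hx,
      pathKernel_eq_cfsV hG hVS hct (ne_of_lt h12) hi₁ hi₂ hx, pathKernel_eq_cfsV hG hVS hct h34 hi₃ hi₄ hx,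
      ← ENNReal.ofReal_mul (evPoly_nonneg _ hx), ← ENNReal.ofReal_mul (evPoly_nonneg _ hx)]
    exact ENNReal.ofReal_le_ofReal key
  · have hmem : ∀ n, n < VS.length → VS.getD n 0 ∈ VS := fun n hn => by
      rw [List.getD_eq_getElem _ _ hn]; exact List.getElem_mem hn
    have hne : VS.getD i₁ 0 ≠ VS.getD i₂ 0 := by
      rw [List.getD_eq_getElem _ _ hi₁, List.getD_eq_getElem _ _ hi₂, Ne, hVS.getElem_inj_iff]
      exact ne_of_lt h12
    exact absurd hI (not_interlaced_of_disjointWitnessV hG hwit (hmem i₁ hi₁) (hmem i₂ hi₂) hne)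

/-- A path with distinct ends starts in the list, and then stays in it. [folklore] -/
theorem mem_of_path (hG : ∀ x y, G.Adj x y ↔ (zdGraph 2).Adj x y ∧ x ∈ VS ∧ y ∈ VS) {u v : Site 2}
    (P : G.Path u v) (huv : u ≠ v) : u ∈ VS ∧ v ∈ VS := by
  obtain ⟨w, hw⟩ := exists_adj_of_walk_ne P.1 huv
  have hu : u ∈ VS := ((hG u w).1 hw).2.1
  exact ⟨hu, forall_mem_support_of_walk hG hu P.1 v P.1.end_mem_support⟩

/-- **TP₂ on the whole of `ℤ²[VS]`**: every interlaced, disjointly realisable quadruple of `G` satisfies TP₂ at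
every `x ∈ [10/27, 5/13]`. [folklore] -/
theorem graphTP2_of_fullCheckV (hG : ∀ x y, G.Adj x y ↔ (zdGraph 2).Adj x y ∧ x ∈ VS ∧ y ∈ VS)
    (hVS : VS.Nodup) (hct : (rowsOf VS).map (List.map fun p : Site 2 × Site 2 => pathCountV VS p.1 p.2) = ctab)
    (hall : ∀ i < VS.length, fullCheckAtV VS K F ctab i = true) {x : ℝ} (hlo : 10 / 27 ≤ x)
    (hhi : x ≤ 5 / 13) (p₁ p₂ p₃ p₄ : Site 2) (hI : Interlaced G p₁ p₂ p₃ p₄)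
    (hD₁ : DisjointPaths G p₁ p₂ p₃ p₄) (hD₂ : DisjointPaths G p₁ p₄ p₂ p₃) :
    pathKernel G x p₁ p₃ * pathKernel G x p₂ p₄ ≤ pathKernel G x p₁ p₂ * pathKernel G x p₃ p₄ := by
  obtain ⟨n12, n13, n14, n23, n24, n34⟩ := pairwise_ne_of_disjointPaths hD₁ hD₂
  -- the four points are listed sites
  obtain ⟨P, Q, -⟩ := hD₁
  obtain ⟨m₁, m₂⟩ := mem_of_path hG P n12
  obtain ⟨m₃, m₄⟩ := mem_of_path hG Q n34
  -- indices
  have idx : ∀ {p : Site 2}, p ∈ VS → ∃ i, i < VS.length ∧ VS.getD i 0 = p := by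
    intro p hp
    obtain ⟨i, hi, hip⟩ := List.mem_iff_getElem.1 hp
    exact ⟨i, hi, by rw [List.getD_eq_getElem _ _ hi, hip]⟩
  obtain ⟨i₁, hi₁, rfl⟩ := idx m₁
  obtain ⟨i₂, hi₂, rfl⟩ := idx m₂
  obtain ⟨i₃, hi₃, rfl⟩ := idx m₃
  obtain ⟨i₄, hi₄, rfl⟩ := idx m₄
  have d12 : i₁ ≠ i₂ := fun h => n12 (by rw [h])
  have d13 : i₁ ≠ i₃ := fun h => n13 (by rw [h])
  have d14 : i₁ ≠ i₄ := fun h => n14 (by rw [h])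
  have d23 : i₂ ≠ i₃ := fun h => n23 (by rw [h])
  have d24 : i₂ ≠ i₄ := fun h => n24 (by rw [h])
  have d34 : i₃ ≠ i₄ := fun h => n34 (by rw [h])
  -- which index is minimal?
  rcases lt_or_gt_of_ne d12 with h12 | h12 <;> rcases lt_or_gt_of_ne d13 with h13 | h13 <;>
    rcases lt_or_gt_of_ne d14 with h14 | h14 <;> rcases lt_or_gt_of_ne d23 with h23 | h23 <;>
    rcases lt_or_gt_of_ne d24 with h24 | h24 <;> rcases lt_or_gt_of_ne d34 with h34 | h34
  all_goals first
    -- `i₁` minimal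
    | exact tp2_canonical_of_fullCheckAtV hG hVS hct (hall i₁ hi₁) h12 h13 h14 d23 d24 d34 hi₂ hi₃ hi₄ hlo
        hhi hI
    -- `i₂` minimal: relabel `(12)(34)`
    | exact tp2_of_swap _ x (tp2_canonical_of_fullCheckAtV hG hVS hct (hall i₂ hi₂) h12 h24 h23 d14 d13
        d34.symm hi₁ hi₄ hi₃ hlo hhi hI.swap)
    -- `i₃` minimal: relabel `(13)(24)`
    | exact tp2_of_rotate _ x (tp2_canonical_of_fullCheckAtV hG hVS hct (hall i₃ hi₃) h34 h13 h23 d14.symm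
        d24.symm d12 hi₄ hi₁ hi₂ hlo hhi hI.rotate)
    -- `i₄` minimal: relabel `(14)(23)`
    | exact tp2_of_reflect _ x (tp2_canonical_of_fullCheckAtV hG hVS hct (hall i₄ hi₄) h34 h24 h14 d23.symm
        d13.symm d12.symm hi₃ hi₂ hi₁ hlo hhi hI.reflect)
    | omega

end GraphFull


open Summit.CriticalPhenomena.SAWScalingLimit.Theorems.BoundaryHarnack.Realisation

/-! ## §4 Lattice-connectedness by enumeration -/

/-- Following neighbour lists inside `VS` is a chain of lattice steps inside `VS`. [folklore] -/
theorem reflTransGen_of_follows {VS : List (Site 2)} :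
    ∀ {cur : Site 2} {rest : List (Site 2)}, cur ∈ VS → Follows (nbrV VS) cur rest →
      Relation.ReflTransGen (SiteStep {v | v ∈ VS}) cur (lastOf cur rest)
  | _, [], _, _ => Relation.ReflTransGen.refl
  | _, _ :: _, hc, h =>
    Relation.ReflTransGen.head ⟨(mem_nbrV_iff.1 h.1).2, hc, (mem_nbrV_iff.1 h.1).1⟩
      (reflTransGen_of_follows (mem_nbrV_iff.1 h.1).1 h.2)

/-- **Connectivity check**: every listed site is the end of an enumerated path from the head. [folklore] -/
def connCheck : List (Site 2) → Bool
  | [] => true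
  | v₀ :: VS' => (v₀ :: VS').all fun y => !(pathsV (v₀ :: VS') v₀ y).isEmpty

/-- **Soundness of the connectivity check.** [folklore] -/
theorem connected_of_connCheck {VS : List (Site 2)} (h : connCheck VS = true) :
    ∀ x ∈ {v | v ∈ VS}, ∀ y ∈ {v | v ∈ VS}, Relation.ReflTransGen (SiteStep {v | v ∈ VS}) x y := by
  cases VS with
  | nil => intro x hx; simp at hx
  | cons v₀ VS' =>
    have hreach : ∀ y ∈ v₀ :: VS', Relation.ReflTransGen (SiteStep {v | v ∈ v₀ :: VS'}) v₀ y := by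
      intro y hy
      have hy' := List.all_eq_true.1 h y hy
      obtain ⟨L, hL⟩ : ∃ L, L ∈ pathsV (v₀ :: VS') v₀ y := by
        cases hl : pathsV (v₀ :: VS') v₀ y with
        | nil => rw [hl] at hy'; simp at hy'
        | cons L l => exact ⟨L, List.mem_cons_self⟩
      obtain ⟨rest, rfl, hf, -, -, hlast⟩ := allPaths_sound (nbrV (v₀ :: VS')) y _ v₀ [] L hL
      rw [← hlast]
      exact reflTransGen_of_follows List.mem_cons_self hf
    intro x hx y hy
    exact (reflTransGen_siteStep_reverse (hreach x hx)).trans (hreach y hy)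

/-! ## §5 The realised domain of a site list -/

/-- The realisation of the site list `VS` inside the box `[lo, hi]`: a bounded simply connected planar domain
with `Ω_1 = ℤ²[VS]`. [folklore] -/
def ΩV (lo hi : Site 2) (VS : List (Site 2)) : Set ℂ := realise lo hi {v | v ∈ VS}

/-- `ΩV` is bounded. [folklore] -/
theorem isBounded_ΩV (lo hi : Site 2) (VS : List (Site 2)) : Bornology.IsBounded (ΩV lo hi VS) :=
  isBounded_realise

/-- `ΩV` is simply connected (non-degenerate box). [folklore] -/
theorem simplyConnectedSpace_ΩV {lo hi : Site 2} (hlh : ∀ i, lo i ≤ hi i) (VS : List (Site 2)) :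
    SimplyConnectedSpace (ΩV lo hi VS) :=
  simplyConnectedSpace_realise hlh

/-- All listed sites lie in the box (a `decide`). [folklore] -/
theorem forall_mem_boxSites_of_all {lo hi : Site 2} {VS : List (Site 2)}
    (h : (VS.all fun v => decide (v ∈ boxSites lo hi)) = true) : ∀ v ∈ VS, v ∈ boxSites lo hi := fun v hv => by
  simpa using List.all_eq_true.1 h v hv

/-- **The domain graph of `ΩV` is `ℤ²` induced on `VS`.** [folklore] -/
theorem adj_ΩV_iff {lo hi : Site 2} {VS : List (Site 2)} (hV : ∀ v ∈ VS, v ∈ boxSites lo hi)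
    (hconn : connCheck VS = true) :
    ∀ x y, (discreteDomainGraph (ΩV lo hi VS) 1).Adj x y ↔ (zdGraph 2).Adj x y ∧ x ∈ VS ∧ y ∈ VS :=
  fun _ _ => adj_realise_iff (V := {v | v ∈ VS}) (fun v hv => hV v hv) (connected_of_connCheck hconn)

/-! ## §6 The certificates in the crux's own terms on `ΩV` -/

/-- **Circular TP₂ of the critical SAW kernel of `ΩV` for a listed cycle `bd ⊆ VS`** (both non-crossing
pairings dominate the crossing one for all `i < j < k < l`; `Z = SAW.weight (ΩV lo hi VS) 1 · · univ`), under
the quoted bounds `2.6 ≤ μ ≤ 2.7`. [folklore] -/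
theorem tp2_weight_ΩV_of_certAll (hμ : SAW.LawlerSchrammWerner2004SAW_connectiveConstant_bounds)
    {lo hi : Site 2} {VS : List (Site 2)} (hV : ∀ v ∈ VS, v ∈ boxSites lo hi) (hconn : connCheck VS = true)
    (hVS : VS.Nodup) {bd : List (Site 2)} (hbd : ∀ u ∈ bd, u ∈ VS) {ctab : List (List (List ℕ))}
    (hct : (rowsOf bd).map (List.map fun p : Site 2 × Site 2 => pathCountV VS p.1 p.2) = ctab)
    {K F : ℕ} (hcert : certAll bd.length K F ctab = true)
    {i j k l : ℕ} (hij : i < j) (hjk : j < k) (hkl : k < l) (hl : l < bd.length) :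
    SAW.weight (ΩV lo hi VS) 1 (bd.getD i 0) (bd.getD k 0) Set.univ *
          SAW.weight (ΩV lo hi VS) 1 (bd.getD j 0) (bd.getD l 0) Set.univ ≤
        SAW.weight (ΩV lo hi VS) 1 (bd.getD i 0) (bd.getD j 0) Set.univ *
          SAW.weight (ΩV lo hi VS) 1 (bd.getD k 0) (bd.getD l 0) Set.univ ∧
      SAW.weight (ΩV lo hi VS) 1 (bd.getD i 0) (bd.getD k 0) Set.univ *
          SAW.weight (ΩV lo hi VS) 1 (bd.getD j 0) (bd.getD l 0) Set.univ ≤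
        SAW.weight (ΩV lo hi VS) 1 (bd.getD i 0) (bd.getD l 0) Set.univ *
          SAW.weight (ΩV lo hi VS) 1 (bd.getD j 0) (bd.getD k 0) Set.univ := by
  simp only [weight_univ_eq_pathKernel]
  exact tp2_graph_of_certAll (adj_ΩV_iff hV hconn) hVS hbd hct hcert (xc_mem_interval hμ).1
    (xc_mem_interval hμ).2 hij hjk hkl hl

/-- **The crux `BoundaryTP2` holds on `Ω = ΩV lo hi VS`, `δ = 1`, as typed** (all quadruples;
`Z = SAW.weight … univ` at `x_c`), under the quoted bounds `2.6 ≤ μ ≤ 2.7`, given the all-pairs table and the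
kernel checks. [folklore] -/
theorem boundaryTP2_ΩV_of_fullCheckV (hμ : SAW.LawlerSchrammWerner2004SAW_connectiveConstant_bounds)
    {lo hi : Site 2} {VS : List (Site 2)} (hV : ∀ v ∈ VS, v ∈ boxSites lo hi) (hconn : connCheck VS = true)
    (hVS : VS.Nodup) {ctab : List (List (List ℕ))}
    (hct : (rowsOf VS).map (List.map fun p : Site 2 × Site 2 => pathCountV VS p.1 p.2) = ctab)
    {K F : ℕ} (hall : ∀ i < VS.length, fullCheckAtV VS K F ctab i = true) (p₁ p₂ p₃ p₄ : Site 2)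
    (hI : ∀ (P : SAW.DomainSAW (ΩV lo hi VS) 1 p₁ p₃) (Q : SAW.DomainSAW (ΩV lo hi VS) 1 p₂ p₄),
      ∃ v, v ∈ P.walk.support ∧ v ∈ Q.walk.support)
    (hD₁ : ∃ (P : SAW.DomainSAW (ΩV lo hi VS) 1 p₁ p₂) (Q : SAW.DomainSAW (ΩV lo hi VS) 1 p₃ p₄),
      List.Disjoint P.walk.support Q.walk.support)
    (hD₂ : ∃ (P : SAW.DomainSAW (ΩV lo hi VS) 1 p₁ p₄) (Q : SAW.DomainSAW (ΩV lo hi VS) 1 p₂ p₃),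
      List.Disjoint P.walk.support Q.walk.support) :
    SAW.weight (ΩV lo hi VS) 1 p₁ p₃ Set.univ * SAW.weight (ΩV lo hi VS) 1 p₂ p₄ Set.univ ≤
      SAW.weight (ΩV lo hi VS) 1 p₁ p₂ Set.univ * SAW.weight (ΩV lo hi VS) 1 p₃ p₄ Set.univ := by
  simp only [weight_univ_eq_pathKernel]
  exact graphTP2_of_fullCheckV (adj_ΩV_iff hV hconn) hVS hct hall (xc_mem_interval hμ).1
    (xc_mem_interval hμ).2 p₁ p₂ p₃ p₄ (interlaced_of_domainSAW hI) (disjointPaths_of_domainSAW hD₁)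
    (disjointPaths_of_domainSAW hD₂)

end Summit.CriticalPhenomena.SAWScalingLimit.Theorems.BoundaryTP2.Negative.Cert
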